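import Literature.Analysis.Calculus.ParametricTransversality
import Mathlib.Analysis.InnerProductSpace.PiL2
import Mathlib.MeasureTheory.Measure.Haar.OfBasis
import HarnessLib

/-!
# Generic translates of plane arcs: transversal crossings and avoided points

Topic `Literature/Topology/FourManifolds` (programme of the fact
`Literature.Topology.FourManifolds.exists_isSimplifiedBrokenLefschetzFibration`, Baykur–Saeki 2017, §2.1
p. 6: for a generic map the fold image has normal crossings and the cusp values lie off the
other branches — achieved by pushing fold arcs, `FoldPushGluing`, the image of the core of a
pushed arc being TRANSLATED by the push parameter `θ ∈ ℝ²`).  Two Sard-type statements about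
translates of `C^∞` plane arcs, read off the tree's parametric transversality theorem
(`Literature.Analysis.Calculus.ParametricTransversality`):

* `ae_translate_cross_transverse` — for almost every `θ`, wherever the translate `c₁ + θ` meets
  `c₂` the two velocity vectors span the plane (normal crossing);
* `ae_translate_ne` — for almost every `θ`, the translate `c₁ + θ` avoids a given point.

Everything is proved; no definitions, no named facts (D-0026).

## References

* R. İ. Baykur, O. Saeki, *Simplifying indefinite fibrations on 4-manifolds*, arXiv:1705.11169,
  §2.1, p. 6. [BaykurSaeki2017]
* M. W. Hirsch, *Differential Topology*, GTM 33 (1976), Ch. 3 §2, Thm. 2.7 (parametric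
  transversality). [HirschDT1976]
-/

noncomputable section

open MeasureTheory Set Function Filter Module
open scoped ContDiff Topology

namespace Literature.Topology.FourManifolds

open Literature.Analysis.Calculus.ParametricTransversality

/-- Local notation: `𝔼 n` is the model Euclidean space `EuclideanSpace ℝ (Fin n)`. -/
local notation "𝔼 " n:arg => EuclideanSpace ℝ (Fin n)

/-- **Generic translates cross transversally.**  Let `c₁, c₂ : ℝ → ℝ²` be `C^∞` on open sets
`U₁, U₂`.  For almost every `θ ∈ ℝ²` (any additive Haar measure): whenever
`c₁ s + θ = c₂ u` with `s ∈ U₁`, `u ∈ U₂`, the velocities `c₁'(s)`, `c₂'(u)` span `ℝ²`.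
[cite: HirschDT1976, Ch. 3 §2, Thm. 2.7] [cite: BaykurSaeki2017, §2.1, p. 6] -/
theorem ae_translate_cross_transverse (μ : Measure (𝔼 2)) [μ.IsAddHaarMeasure]
    {c₁ c₂ : ℝ → 𝔼 2} {U₁ U₂ : Set ℝ} (hU₁ : IsOpen U₁) (hU₂ : IsOpen U₂)
    (hc₁ : ContDiffOn ℝ ∞ c₁ U₁) (hc₂ : ContDiffOn ℝ ∞ c₂ U₂) :
    ∀ᵐ θ ∂μ, ∀ s ∈ U₁, ∀ u ∈ U₂, c₁ s + θ = c₂ u →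
      ∀ v : 𝔼 2, ∃ a b : ℝ, a • deriv c₁ s + b • deriv c₂ u = v := by
  set G : 𝔼 2 × (ℝ × ℝ) → 𝔼 2 := fun z => c₁ z.2.1 + z.1 - c₂ z.2.2 with hG
  set Ω : Set (𝔼 2 × (ℝ × ℝ)) := (univ : Set (𝔼 2)) ×ˢ (U₁ ×ˢ U₂) with hΩ
  have hΩo : IsOpen Ω := isOpen_univ.prod (hU₁.prod hU₂)
  -- smoothness on `Ω`
  have hp1 : ContDiff ℝ ∞ fun z : 𝔼 2 × (ℝ × ℝ) => z.2.1 := contDiff_fst.comp contDiff_snd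
  have hp2 : ContDiff ℝ ∞ fun z : 𝔼 2 × (ℝ × ℝ) => z.2.2 := contDiff_snd.comp contDiff_snd
  have hGs : ContDiffOn ℝ ∞ G Ω :=
    ((hc₁.comp hp1.contDiffOn fun z hz => hz.2.1).add contDiffOn_fst).sub
      (hc₂.comp hp2.contDiffOn fun z hz => hz.2.2)
  -- the derivative of `G`
  set π₁ : 𝔼 2 × (ℝ × ℝ) →L[ℝ] ℝ :=
    (ContinuousLinearMap.fst ℝ ℝ ℝ).comp (ContinuousLinearMap.snd ℝ (𝔼 2) (ℝ × ℝ)) with hπ₁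
  set π₂ : 𝔼 2 × (ℝ × ℝ) →L[ℝ] ℝ :=
    (ContinuousLinearMap.snd ℝ ℝ ℝ).comp (ContinuousLinearMap.snd ℝ (𝔼 2) (ℝ × ℝ)) with hπ₂
  set L : 𝔼 2 × (ℝ × ℝ) → (𝔼 2 × (ℝ × ℝ) →L[ℝ] 𝔼 2) := fun z =>
    (ContinuousLinearMap.toSpanSingleton ℝ (deriv c₁ z.2.1)).comp π₁ +
      ContinuousLinearMap.fst ℝ (𝔼 2) (ℝ × ℝ) -
      (ContinuousLinearMap.toSpanSingleton ℝ (deriv c₂ z.2.2)).comp π₂ with hL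
  have hGd : ∀ z ∈ Ω, HasFDerivAt G (L z) z := by
    rintro ⟨θ, s, u⟩ ⟨-, hs, hu⟩
    have h1 : HasDerivAt c₁ (deriv c₁ s) s :=
      ((hc₁.contDiffAt (hU₁.mem_nhds hs)).differentiableAt (by simp)).hasDerivAt
    have h2 : HasDerivAt c₂ (deriv c₂ u) u :=
      ((hc₂.contDiffAt (hU₂.mem_nhds hu)).differentiableAt (by simp)).hasDerivAt
    have h1' := h1.hasFDerivAt.comp ((θ, s, u) : 𝔼 2 × (ℝ × ℝ)) π₁.hasFDerivAt
    have h2' := h2.hasFDerivAt.comp ((θ, s, u) : 𝔼 2 × (ℝ × ℝ)) π₂.hasFDerivAt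
    exact (h1'.add (ContinuousLinearMap.fst ℝ (𝔼 2) (ℝ × ℝ)).hasFDerivAt).sub h2'
  -- `∂_θ G = id` is onto
  have h₁ : ∀ z ∈ Ω, G z = 0 →
      Surjective (fderiv ℝ G z ∘L ContinuousLinearMap.inl ℝ (𝔼 2) (ℝ × ℝ)) := by
    intro z hz _
    rw [(hGd z hz).fderiv]
    intro w
    refine ⟨w, ?_⟩
    simp [hL, hπ₁, hπ₂]
  filter_upwards [ae_surjective_fderiv_inr μ hΩo hGs h₁] with θ hθ s hs u hu hsu v
  have hz : ((θ, (s, u)) : 𝔼 2 × (ℝ × ℝ)) ∈ Ω := ⟨mem_univ _, hs, hu⟩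
  have h0 : G (θ, (s, u)) = 0 := by
    simp only [hG]
    rw [hsu, sub_self]
  obtain ⟨⟨a, b⟩, hab⟩ := hθ (s, u) hz h0 v
  rw [(hGd _ hz).fderiv] at hab
  refine ⟨a, -b, ?_⟩
  have : (L (θ, (s, u))) (ContinuousLinearMap.inr ℝ (𝔼 2) (ℝ × ℝ) (a, b)) = v := hab
  simp [hL, hπ₁, hπ₂] at this
  rw [← this]
  simp only [neg_smul]
  abel

/-- **Generic translates avoid a point.**  For almost every `θ ∈ ℝ²`, the translate `c + θ` of
a `C^∞` arc misses the point `w` (`dim ℝ = 1 < 2`).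
[cite: HirschDT1976, Ch. 3 §2, Thm. 2.7] [cite: BaykurSaeki2017, §2.1, p. 6] -/
theorem ae_translate_ne (μ : Measure (𝔼 2)) [μ.IsAddHaarMeasure] {c : ℝ → 𝔼 2} {U : Set ℝ}
    (hU : IsOpen U) (hc : ContDiffOn ℝ ∞ c U) (w : 𝔼 2) :
    ∀ᵐ θ ∂μ, ∀ s ∈ U, c s + θ ≠ w := by
  set G : 𝔼 2 × ℝ → 𝔼 2 := fun z => c z.2 + z.1 - w with hG
  set Ω : Set (𝔼 2 × ℝ) := (univ : Set (𝔼 2)) ×ˢ U with hΩ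
  have hΩo : IsOpen Ω := isOpen_univ.prod hU
  have hGs : ContDiffOn ℝ ∞ G Ω :=
    ((hc.comp contDiff_snd.contDiffOn fun z hz => hz.2).add contDiffOn_fst).sub contDiffOn_const
  set L : 𝔼 2 × ℝ → (𝔼 2 × ℝ →L[ℝ] 𝔼 2) := fun z =>
    (ContinuousLinearMap.toSpanSingleton ℝ (deriv c z.2)).comp (ContinuousLinearMap.snd ℝ (𝔼 2) ℝ) +
      ContinuousLinearMap.fst ℝ (𝔼 2) ℝ with hL
  have hGd : ∀ z ∈ Ω, HasFDerivAt G (L z) z := by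
    rintro ⟨θ, s⟩ ⟨-, hs⟩
    have h1 : HasDerivAt c (deriv c s) s :=
      ((hc.contDiffAt (hU.mem_nhds hs)).differentiableAt (by simp)).hasDerivAt
    have h1' := h1.hasFDerivAt.comp ((θ, s) : 𝔼 2 × ℝ) (ContinuousLinearMap.snd ℝ (𝔼 2) ℝ).hasFDerivAt
    exact (h1'.add (ContinuousLinearMap.fst ℝ (𝔼 2) ℝ).hasFDerivAt).sub_const w
  have h₁ : ∀ z ∈ Ω, G z = 0 →
      Surjective (fderiv ℝ G z ∘L ContinuousLinearMap.inl ℝ (𝔼 2) ℝ) := by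
    intro z hz _
    rw [(hGd z hz).fderiv]
    intro w'
    refine ⟨w', ?_⟩
    simp [hL]
  have hdim : finrank ℝ ℝ < finrank ℝ (𝔼 2) := by simp
  filter_upwards [ae_forall_ne_zero_of_finrank_lt μ hΩo hGs h₁ hdim] with θ hθ s hs heq
  exact hθ s ⟨mem_univ _, hs⟩ (by simp only [hG]; rw [heq, sub_self])

end Literature.Topology.FourManifolds
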